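/-
Origin: expansion seat `planner-pub-hodgecm-pv12-g7-0`, handover #6 2026-08-18T10:19:26Z (`HOME/pub-hodgecm-pv12-g7/lean/Pv12g7/FockPrintConjPlane.lean`, md5 df1b814f, 396 lines);
landed by the gen-7 packager in gate run 28 as `HodgeCM/PerL34/FockPrintConjPlane.lean` (import ^import Pv[0-9]+g[0-9]+\.→import HodgeCM.PerL34. ×1).
-/
/-
Copyright (c) 2026. Released under the Apache-2.0 license.
-/
import Summits.HodgeConjecture.HodgeCM.PerL34.FockPrintTwist

/-!
# The conjugate plane model at `ι₁` (`W_{ι₁}` NEGATIVE definite): `κ = (1,1;−2)` is never reachable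

Origin: expansion seat `planner-pub-hodgecm-pv12-g7-0` (unit `pub-hodgecm-pv12-g7`, DAG-node prover #12 gen 7, the
Fock-model seat).  WIP module `Pv12g7.FockPrintConjPlane`; intended final place `HodgeCM/PerL34/FockPrintConjPlane.lean`
with import `HodgeCM.PerL34.FockPrintTwist` (this seat #5, run 28/29; rewrite `^import Pv12g7\.` ↦ `import HodgeCM.PerL34.`).
Asserts nothing: no new constants, no `axiom`, complete proofs.

Node / dictionary: LEMMAS §1 **N26 / N28 at `ι₁`**, setup **D4/D5**, and the adversary's WARRANT OBJECTION **adv2g23-O6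
(R1), MODEL B** (GAPS l. 6883; this seat's answer GAPS `## pub-hodgecm-pv12-g7 — addendum 3` pv12g7-6): the companion of
`FockPrintTwist` §4 for the OTHER sign of the hermitian plane `W_{ι₁} = W_{1,ι₁} ⊕ W_{2,ι₁}`.

PRINT (the dictionary; nothing of it is asserted): Adams's Fock model of the oscillator representation for a hermitian
form of arbitrary signs ([Ad07] J. Adams, *The theta correspondence over ℝ*, Lect. Notes Ser. IMS NUS 12 (2007), §2
(2.5)(a)(b) and §4 — `FockPrintDictionary` §3–§4: `sf s`, `ee s`, `ff s`, `rho s`, `fockOp`, generic in the sign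
function `s`; `FockPrintTwoLines` §1: the twelve sign lemmas `sf_rho_ee_ff_pp/nn/pn/np`, …).  For `V_{ι₁}` of signature
`(2,1)` and `W_{ι₁}` NEGATIVE definite of dimension 2 the signs of `h_V ⊗ h_W` on `V ⊗ W = ⊕_j (V⁺ ⊗ w_j) ⊕ (V⁻ ⊗ w_j)`
are `(+,+,−) ⊗ (−,−)`: **`−` on the indices `inl (a,j)`** (letters `z_{aj}`) and **`+` on `inr j`** (letters `w_j`) —
`conjWt = −planeWt`.  Cross-check of the resulting compact weights against print: A. Paul, J. Funct. Anal. 159 (1998),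
Lemma 1.4.5 (1) [corpus:paper:doi-10-1006-jfan-1998-3330 p0009 L15–47, printed p. 392] with `(p,q) = (2,1)`,
`(r,s) = (0,2)`: base point `((r−s)/2, (r−s)/2; (s−r)/2) = (−1,−1;1)` and harmonic types `(−1+b₁, −1+b₂; 1+c)`, `b ≤ 0 ≤ c`
— the adversary's MODEL B table at `α = 0`.

KERNEL (this file; ns `HodgeCM.PerL34.Fock.PrintDict`, same polynomial ring `PlaneModel = ℂ[z_{aj}, w_j]` as `ArchB` —
the letters now stand for the creation coordinates of the conjugate model, which is immaterial for the algebra):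
* `conjWt`, `isDarboux_conjWt`, `J0_conjWt_pos` (Adams's §2/§4 apply);
* `fockOp_rho_plV_conj` — the printed operator of `ρ^B(A ⊗ 1)`, `A ∈ 𝔤𝔩(V) = 𝔲(2,1)_ℂ`, in closed form:
  `−Σ_{a,b} A_{ab} Σ_j z_{bj}∂_{z_{aj}} + A_{ww} Σ_j w_j∂_{w_j}` (compact part: DUAL on the row index of `z`, standard on `w`)
  `+ (i/λ) Σ_a A_{wa} Σ_j z_{aj}w_j + iλ Σ_a A_{aw} Σ_j ∂_{z_{aj}}∂_{w_j}` (`𝔭_±` with the roles of `A_{aw}`, `A_{wa}` exchanged)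
  `+ (A_{ww} − A₀₀ − A₁₁)` (constants of weight **`(−1,−1;1)`**);
* compact torus and roots: `fockOp_rho_plV_conj_row = −(weightOp (rowWt a) + 1)`, `_wline = weightOp wWt + 1`,
  `_raise = −Eminus`, `_lower = −Eplus`;
* the twist (ID-5 law as a definition, as in `FockPrintTwist`): `fockOpTwB λ α A := ρ^B(A ⊗ 1) + (α/2)·tr(A)·1`,
  `fockOpTwB_row = −weightOp (rowWt a) + (−1 + α/2)•1`, `fockOpTwB_wline = weightOp wWt + (1 + α/2)•1`, vacuum weight
  **`(−1 + α/2, −1 + α/2; 1 + α/2)`** = the adversary's `((α−2)/2, (α−2)/2; (2+α)/2)`;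
* **`not_exists_isKappaVectorTwB λ α : ¬ ∃ f ≠ 0, IsKappaVectorTwB λ α f` for EVERY `α ∈ ℤ`** — a `κ = (1,1;−2)`-vector
  would need row weight `α/2 − 2 ≥ 0` and `w`-degree `−3 − α/2 ≥ 0` on a support monomial, i.e. `α ≥ 4 ∧ α ≤ −6`;
* both models in one statement (the shape requested in adv2g23-O6 (R1)): `PlaneSign`, `IsKappaVectorSgn`,
  **`kappaReachable_iff : (∃ f ≠ 0, IsKappaVectorSgn s λ α f) ↔ s = pos ∧ (α = −2 ∨ α = 0)`** and
  **`kappaReachable_iff_of_data (hα : α = 2 ∨ α = −2) : (∃ f ≠ 0, IsKappaVectorSgn s λ α f) ↔ s = pos ∧ α = −2`**.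
CONSEQUENCE (for the objection, not a kernel statement about PerL): granted the datum's constraint `α ∈ {±2}`, the
non-vanishing of `𝓕^κ_{ι₁}` forces BOTH the relative sign `s = pos` AND the label `(0,0;−2)` (`α = −2`); neither is a
free convention.

WHAT `PlaneSign` IS (dictionary D4, not asserted; answers adv2g24-X52's refinement "`s = sign ψ_{ι₁}`"): in this kernel
dictionary the creation/annihilation assignment `ee s / ff s` — hence which model, A or B, one is in — is determined by the
sign function `s` ALONE, and the character parameter `λ` enters `fockOp` only as the non-zero scalar of the `𝔭_±`-terms
(`(2λ)⁻¹`, `λ/2`), never in the compact part.  So `s` is the sign of `h_V ⊗ h_W` RELATIVE to the fixed additive character of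
[Ad07] §2: `pos` = (`W_{ι₁}` positive for Adams's `ψ`) = (`W_{ι₁}` negative for `ψ̄`), i.e. `pos ↔ sign W_{ι₁} = sign ψ_{ι₁}`
in the adversary's notation; the kernel statements below are about the relative sign and do not decide which physical
pair PerL's D4 fixes.  PerL / [Y1neg] are NOT cited as facts anywhere in this file.
-/

set_option autoImplicit false

namespace HodgeCM
namespace PerL34
namespace Fock
namespace PrintDict

open MvPolynomial Complex
open scoped BigOperators

section ConjPlane

/-! ## 1. Signs of the conjugate model -/

/-- Signs of `h_V ⊗ h_W` at `ι₁` with `W_{ι₁}` NEGATIVE definite: `−` on `inl (a,j)` (`V⁺ ⊗ W`), `+` on `inr j`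
(`V⁻ ⊗ W`); `= −planeWt`. -/
def conjWt : PlaneVar → ℤ := Sum.elim (fun _ => -1) (fun _ => 1)

/-- (Ported verbatim from the HodgeCMPerL package; no docstring in the source.) -/
@[simp] theorem conjWt_inl (v : Fin 2 × Fin 2) : conjWt (Sum.inl v) = -1 := rfl
/-- (Ported verbatim from the HodgeCMPerL package; no docstring in the source.) -/
@[simp] theorem conjWt_inr (j : Fin 2) : conjWt (Sum.inr j) = 1 := rfl

/-- (Ported verbatim from the HodgeCMPerL package; no docstring in the source.) -/
theorem conjWt_eq_neg_planeWt : conjWt = -planeWt := by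
  funext k; rcases k with v | j <;> simp

/-- (Ported verbatim from the HodgeCMPerL package; no docstring in the source.) -/
theorem conjWt_signs : ∀ k, conjWt k = 1 ∨ conjWt k = -1 := by rintro (v | j) <;> simp

/-- (Ported verbatim from the HodgeCMPerL package; no docstring in the source.) -/
theorem conjWt_sq : ∀ k, conjWt k * conjWt k = 1 := by rintro (v | j) <;> simp

/-- Adams §2: the datum is Darboux (bookkeeping instance of `FockPrintDictionary.isDarboux_of_signs`). -/
theorem isDarboux_conjWt : IsDarboux (sf conjWt) (ee conjWt) (ff conjWt) := isDarboux_of_signs conjWt_signs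

/-- Adams §4 positivity of `J₀` on real points (bookkeeping instance of `FockPrintDictionary.J0_pos_of_signs`). -/
theorem J0_conjWt_pos (x : PlaneVar → ℂ) :
    sf conjWt (x, star x) (J0 conjWt (x, star x)) = 2 * ∑ k, (Complex.normSq (x k) : ℂ) :=
  J0_pos_of_signs conjWt_sq x

/-! ### The blocks of `ρ^B(X)` (instances of `FockPrintTwoLines` §1 with the signs of `conjWt`) -/

section Blocks

variable (X : Matrix PlaneVar PlaneVar ℂ) (v v' : Fin 2 × Fin 2) (j j' : Fin 2)

/-- (Ported verbatim from the HodgeCMPerL package; no docstring in the source.) -/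
theorem cA_ll : sf conjWt (rho conjWt X (ee conjWt (Sum.inl v'))) (ff conjWt (Sum.inl v)) =
    X (Sum.inl v) (Sum.inl v') := sf_rho_ee_ff_nn conjWt X rfl rfl
/-- (Ported verbatim from the HodgeCMPerL package; no docstring in the source.) -/
theorem cA_rr : sf conjWt (rho conjWt X (ee conjWt (Sum.inr j'))) (ff conjWt (Sum.inr j)) =
    -X (Sum.inr j') (Sum.inr j) := sf_rho_ee_ff_pp conjWt X rfl rfl
/-- (Ported verbatim from the HodgeCMPerL package; no docstring in the source.) -/
theorem cA_lr : sf conjWt (rho conjWt X (ee conjWt (Sum.inr j'))) (ff conjWt (Sum.inl v)) = 0 :=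
  sf_rho_ee_ff_np conjWt X rfl rfl
/-- (Ported verbatim from the HodgeCMPerL package; no docstring in the source.) -/
theorem cA_rl : sf conjWt (rho conjWt X (ee conjWt (Sum.inl v'))) (ff conjWt (Sum.inr j)) = 0 :=
  sf_rho_ee_ff_pn conjWt X rfl rfl
/-- (Ported verbatim from the HodgeCMPerL package; no docstring in the source.) -/
theorem cB_ll : sf conjWt (rho conjWt X (ff conjWt (Sum.inl v'))) (ff conjWt (Sum.inl v)) = 0 :=
  sf_rho_ff_ff_nn conjWt X rfl rfl
/-- (Ported verbatim from the HodgeCMPerL package; no docstring in the source.) -/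
theorem cB_rr : sf conjWt (rho conjWt X (ff conjWt (Sum.inr j'))) (ff conjWt (Sum.inr j)) = 0 :=
  sf_rho_ff_ff_pp conjWt X rfl rfl
/-- (Ported verbatim from the HodgeCMPerL package; no docstring in the source.) -/
theorem cB_lr : sf conjWt (rho conjWt X (ff conjWt (Sum.inr j'))) (ff conjWt (Sum.inl v)) =
    I * X (Sum.inl v) (Sum.inr j') := sf_rho_ff_ff_np conjWt X rfl rfl
/-- (Ported verbatim from the HodgeCMPerL package; no docstring in the source.) -/
theorem cB_rl : sf conjWt (rho conjWt X (ff conjWt (Sum.inl v'))) (ff conjWt (Sum.inr j)) =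
    I * X (Sum.inl v') (Sum.inr j) := sf_rho_ff_ff_pn conjWt X rfl rfl
/-- (Ported verbatim from the HodgeCMPerL package; no docstring in the source.) -/
theorem cC_ll : sf conjWt (ee conjWt (Sum.inl v)) (rho conjWt X (ee conjWt (Sum.inl v'))) = 0 :=
  sf_ee_rho_ee_nn conjWt X rfl rfl
/-- (Ported verbatim from the HodgeCMPerL package; no docstring in the source.) -/
theorem cC_rr : sf conjWt (ee conjWt (Sum.inr j)) (rho conjWt X (ee conjWt (Sum.inr j'))) = 0 :=
  sf_ee_rho_ee_pp conjWt X rfl rfl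
/-- (Ported verbatim from the HodgeCMPerL package; no docstring in the source.) -/
theorem cC_lr : sf conjWt (ee conjWt (Sum.inl v)) (rho conjWt X (ee conjWt (Sum.inr j'))) =
    -(I * X (Sum.inr j') (Sum.inl v)) := sf_ee_rho_ee_np conjWt X rfl rfl
/-- (Ported verbatim from the HodgeCMPerL package; no docstring in the source.) -/
theorem cC_rl : sf conjWt (ee conjWt (Sum.inr j)) (rho conjWt X (ee conjWt (Sum.inl v'))) =
    -(I * X (Sum.inr j) (Sum.inl v')) := sf_ee_rho_ee_pn conjWt X rfl rfl

end Blocks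

/-! ## 2. The `U(V)`-side operator `ρ^B(A ⊗ 1)` in closed form -/

/-- **MAIN COMPUTATION at `ι₁`, conjugate model, `U(V)`-side (KERNEL)**: for `A ∈ 𝔤𝔩(V) = 𝔲(2,1)_ℂ`, Adams's Fock
operator of `ρ^B(A ⊗ 1)` on `ℂ[z_{aj}, w_j]` with the signs `conjWt` is
`−Σ_{a,b} A_{ab} Σ_j z_{bj}∂_{z_{aj}} + A_{ww} Σ_j w_j∂_{w_j} + (i/λ) Σ_a A_{wa} Σ_j z_{aj}w_j + iλ Σ_a A_{aw} Σ_j ∂_{z_{aj}}∂_{w_j}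
 + (A_{ww} − A₀₀ − A₁₁)` — compare `FockPrintPlane.fockOp_rho_plV` (all compact signs and the `𝔭_±`-roles reversed). -/
theorem fockOp_rho_plV_conj (lam : ℂ) (A : Matrix HarmVar HarmVar ℂ) :
    fockOp (sf conjWt) (ee conjWt) (ff conjWt) lam (rho conjWt (plV A)) =
      -(∑ a : Fin 2, ∑ b : Fin 2, A (Sum.inl a) (Sum.inl b) •
          (∑ j : Fin 2, mz (σ := PlaneVar) (Sum.inl (b, j)) * dz (Sum.inl (a, j))))
        + A (Sum.inr ()) (Sum.inr ()) • (∑ j : Fin 2, mz (σ := PlaneVar) (Sum.inr j) * dz (Sum.inr j))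
        + ∑ a : Fin 2, (I * lam⁻¹ * A (Sum.inr ()) (Sum.inl a)) •
          (∑ j : Fin 2, mz (σ := PlaneVar) (Sum.inl (a, j)) * mz (Sum.inr j))
        + ∑ a : Fin 2, (I * lam * A (Sum.inl a) (Sum.inr ())) •
          (∑ j : Fin 2, dz (σ := PlaneVar) (Sum.inl (a, j)) * dz (Sum.inr j))
        + (A (Sum.inr ()) (Sum.inr ()) - A (Sum.inl 0) (Sum.inl 0) - A (Sum.inl 1) (Sum.inl 1)) •
          (1 : Module.End ℂ PlaneModel) := by
  rw [fockOp_apply]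
  simp only [Fintype.sum_sum_type, Fintype.sum_prod_type, cA_ll, cA_rr, cA_lr, cA_rl, cB_ll, cB_rr, cB_lr, cB_rl,
    cC_ll, cC_rr, cC_lr, cC_rl, plV_ll, plV_lr, plV_rl, plV_rr, zero_smul, Finset.sum_const_zero, add_zero, zero_add]
  simp only [Fin.sum_univ_two, Fin.isValue, if_true, smul_add, mz_inr_mul_inl_plane, dz_inr_mul_inl_plane]
  simp
  module

/-! ## 3. Compact torus and root operators of `𝔲(2)_V` in the conjugate model -/

/-- Row weight operator with the DUAL index order equals `ArchB`'s `weightOp (rowWt a)` (bookkeeping: for a diagonal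
unit the two index orders coincide). -/
theorem weightOp_rowWt_eq' (a : Fin 2) :
    (weightOp (rowWt a) : Module.End ℂ PlaneModel) =
      ∑ j : Fin 2, mz (σ := PlaneVar) (Sum.inl (a, j)) * dz (Sum.inl (a, j)) := weightOp_rowWt_eq a

/-- `U(2)_V`-torus, conjugate model: `ρ^B(E_{aa} ⊗ 1) ↦ −(weightOp (rowWt a) + 1)` (KERNEL) — dual action on the `z`-rows,
vacuum value `−1` per row (Paul's base point `(−1,−1;·)` for `(r,s) = (0,2)`). -/
theorem fockOp_rho_plV_conj_row (lam : ℂ) (a : Fin 2) :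
    fockOp (sf conjWt) (ee conjWt) (ff conjWt) lam (rho conjWt (plV (Matrix.single (Sum.inl a) (Sum.inl a) 1))) =
      -(weightOp (rowWt a) + (1 : Module.End ℂ PlaneModel)) := by
  rw [fockOp_rho_plV_conj, weightOp_rowWt_eq]
  fin_cases a <;> simp [single_apply', Fin.sum_univ_two] <;> module

/-- `U(1)_V`-torus, conjugate model: `ρ^B(E_{ww} ⊗ 1) ↦ weightOp wWt + 1` (KERNEL) — standard action on the `w_j`,
vacuum value `+1` (Paul's `(·;1)`). -/
theorem fockOp_rho_plV_conj_wline (lam : ℂ) :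
    fockOp (sf conjWt) (ee conjWt) (ff conjWt) lam
        (rho conjWt (plV (Matrix.single (Sum.inr ()) (Sum.inr ()) 1))) =
      weightOp wWt + (1 : Module.End ℂ PlaneModel) := by
  rw [fockOp_rho_plV_conj, weightOp_wWt_eq]
  simp [Fin.sum_univ_two]

/-- Raising root operator, conjugate model: `ρ^B(E₀₁ ⊗ 1) ↦ −Σ_j z_{1j}∂_{z_{0j}} = −Eminus` (KERNEL). -/
theorem fockOp_rho_plV_conj_raise (lam : ℂ) :
    fockOp (sf conjWt) (ee conjWt) (ff conjWt) lam (rho conjWt (plV (Matrix.single (Sum.inl 0) (Sum.inl 1) 1))) =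
      -(Eminus : Module.End ℂ PlaneModel) := by
  rw [fockOp_rho_plV_conj]
  apply LinearMap.ext
  intro g
  rw [LinearMap.neg_apply, Eminus_apply]
  simp [single_apply', Fin.sum_univ_two, z]

/-- Lowering root operator, conjugate model: `ρ^B(E₁₀ ⊗ 1) ↦ −Σ_j z_{0j}∂_{z_{1j}} = −Eplus` (KERNEL). -/
theorem fockOp_rho_plV_conj_lower (lam : ℂ) :
    fockOp (sf conjWt) (ee conjWt) (ff conjWt) lam (rho conjWt (plV (Matrix.single (Sum.inl 1) (Sum.inl 0) 1))) =
      -(Eplus : Module.End ℂ PlaneModel) := by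
  rw [fockOp_rho_plV_conj]
  apply LinearMap.ext
  intro g
  rw [LinearMap.neg_apply, Eplus_apply]
  simp [single_apply', Fin.sum_univ_two, z]

/-- The constants in the conjugate model have `K̃_V`-weight `(−1,−1;1)` at the base point (KERNEL): rows `−1`, `w`-line `+1`. -/
theorem fockOp_rho_plV_conj_vacuum (lam : ℂ) :
    (∀ a : Fin 2, fockOp (sf conjWt) (ee conjWt) (ff conjWt) lam
        (rho conjWt (plV (Matrix.single (Sum.inl a) (Sum.inl a) 1))) (1 : PlaneModel) = -(1 : PlaneModel)) ∧
    fockOp (sf conjWt) (ee conjWt) (ff conjWt) lam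
        (rho conjWt (plV (Matrix.single (Sum.inr ()) (Sum.inr ()) 1))) (1 : PlaneModel) = (1 : PlaneModel) := by
  refine ⟨fun a => ?_, ?_⟩
  · rw [fockOp_rho_plV_conj_row, LinearMap.neg_apply, LinearMap.add_apply, weightOp_one, Module.End.one_apply, zero_add]
  · rw [fockOp_rho_plV_conj_wline, LinearMap.add_apply, weightOp_one, Module.End.one_apply, zero_add]

/-! ## 4. The twist in the conjugate model and the non-reachability of `κ` -/

/-- **The split Fock operator of the conjugate model with twist `α`** (ID-5 law as a DEFINITION, as in `FockPrintTwist`):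
`ρ^B_α(A ⊗ 1) := ρ^B(A ⊗ 1) + (α/2)·tr(A)·1`. -/
noncomputable def fockOpTwB (lam : ℂ) (α : ℤ) (A : Matrix HarmVar HarmVar ℂ) : Module.End ℂ PlaneModel :=
  fockOp (sf conjWt) (ee conjWt) (ff conjWt) lam (rho conjWt (plV A)) +
    ((α : ℂ) / 2 * A.trace) • (1 : Module.End ℂ PlaneModel)

/-- (Ported verbatim from the HodgeCMPerL package; no docstring in the source.) -/
theorem fockOpTwB_def (lam : ℂ) (α : ℤ) (A : Matrix HarmVar HarmVar ℂ) :
    fockOpTwB lam α A = fockOp (sf conjWt) (ee conjWt) (ff conjWt) lam (rho conjWt (plV A)) +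
      ((α : ℂ) / 2 * A.trace) • (1 : Module.End ℂ PlaneModel) := rfl

/-- (Ported verbatim from the HodgeCMPerL package; no docstring in the source.) -/
theorem fockOpTwB_zero (lam : ℂ) (A : Matrix HarmVar HarmVar ℂ) :
    fockOpTwB lam 0 A = fockOp (sf conjWt) (ee conjWt) (ff conjWt) lam (rho conjWt (plV A)) := by
  simp [fockOpTwB]

/-- (Ported verbatim from the HodgeCMPerL package; no docstring in the source.) -/
theorem fockOpTwB_single_offDiag (lam : ℂ) (α : ℤ) {i j : HarmVar} (h : i ≠ j) :
    fockOpTwB lam α (Matrix.single i j 1) =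
      fockOp (sf conjWt) (ee conjWt) (ff conjWt) lam (rho conjWt (plV (Matrix.single i j 1))) := by
  rw [fockOpTwB, Matrix.trace_single_eq_of_ne i j 1 h, mul_zero, zero_smul, add_zero]

/-- The twist is invisible on commutators (KERNEL). -/
theorem fockOpTwB_lie (lam : ℂ) (α : ℤ) (A B : Matrix HarmVar HarmVar ℂ) :
    ⁅fockOpTwB lam α A, fockOpTwB lam α B⁆ =
      ⁅fockOp (sf conjWt) (ee conjWt) (ff conjWt) lam (rho conjWt (plV A)),
        fockOp (sf conjWt) (ee conjWt) (ff conjWt) lam (rho conjWt (plV B))⁆ := by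
  simp only [fockOpTwB, Ring.lie_def, mul_add, add_mul, mul_smul_comm, smul_mul_assoc, mul_one, one_mul]
  module

/-- (Ported verbatim from the HodgeCMPerL package; no docstring in the source.) -/
theorem fockOpTwB_apply_lie (lam : ℂ) (α : ℤ) (A B : Matrix HarmVar HarmVar ℂ) :
    fockOpTwB lam α ⁅A, B⁆ = fockOp (sf conjWt) (ee conjWt) (ff conjWt) lam (rho conjWt (plV ⁅A, B⁆)) := by
  have h : Matrix.trace ⁅A, B⁆ = 0 := by
    rw [Ring.lie_def, Matrix.trace_sub, Matrix.trace_mul_comm, sub_self]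
  rw [fockOpTwB, h, mul_zero, zero_smul, add_zero]

/-- Twisted `U(2)_V`-torus, conjugate model: `ρ^B_α(E_{aa} ⊗ 1) = −weightOp (rowWt a) + (−1 + α/2)•1` (KERNEL). -/
theorem fockOpTwB_row (lam : ℂ) (α : ℤ) (a : Fin 2) :
    fockOpTwB lam α (Matrix.single (Sum.inl a) (Sum.inl a) 1) =
      -weightOp (rowWt a) + (-1 + (α : ℂ) / 2) • (1 : Module.End ℂ PlaneModel) := by
  rw [fockOpTwB, fockOp_rho_plV_conj_row, Matrix.trace_single_eq_same, mul_one]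
  module

/-- Twisted `U(1)_V`-torus, conjugate model: `ρ^B_α(E_{ww} ⊗ 1) = weightOp wWt + (1 + α/2)•1` (KERNEL). -/
theorem fockOpTwB_wline (lam : ℂ) (α : ℤ) :
    fockOpTwB lam α (Matrix.single (Sum.inr ()) (Sum.inr ()) 1) =
      weightOp wWt + (1 + (α : ℂ) / 2) • (1 : Module.End ℂ PlaneModel) := by
  rw [fockOpTwB, fockOp_rho_plV_conj_wline, Matrix.trace_single_eq_same, mul_one]
  module

/-- Vacuum weight of the conjugate model at twist `α`: `(−1 + α/2, −1 + α/2; 1 + α/2)` (KERNEL) — the adversary's MODEL B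
line `((α−2)/2, (α−2)/2; (2+α)/2)`. -/
theorem fockOpTwB_vacuum (lam : ℂ) (α : ℤ) :
    (∀ a : Fin 2, fockOpTwB lam α (Matrix.single (Sum.inl a) (Sum.inl a) 1) (1 : PlaneModel) =
        (-1 + (α : ℂ) / 2) • (1 : PlaneModel)) ∧
    fockOpTwB lam α (Matrix.single (Sum.inr ()) (Sum.inr ()) 1) (1 : PlaneModel) = (1 + (α : ℂ) / 2) • (1 : PlaneModel) := by
  refine ⟨fun a => ?_, ?_⟩
  · rw [fockOpTwB_row, LinearMap.add_apply, LinearMap.neg_apply, LinearMap.smul_apply, weightOp_one,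
      Module.End.one_apply, neg_zero, zero_add]
  · rw [fockOpTwB_wline, LinearMap.add_apply, LinearMap.smul_apply, weightOp_one, Module.End.one_apply, zero_add]

/-- (Ported verbatim from the HodgeCMPerL package; no docstring in the source.) -/
private theorem inl0_ne_inl1' : (Sum.inl 0 : HarmVar) ≠ Sum.inl 1 := by decide
/-- (Ported verbatim from the HodgeCMPerL package; no docstring in the source.) -/
private theorem inl1_ne_inl0' : (Sum.inl 1 : HarmVar) ≠ Sum.inl 0 := by decide

/-- **`κ`-vectors of the conjugate model at twist `α`**: `ρ^B_α`-weight `κ = (1,1;−2)` and killed by the `𝔲(2)_V`-roots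
(a `structure`, for the reason recorded at `FockPrintTwist.isKappaVectorTw_iff`). -/
structure IsKappaVectorTwB (lam : ℂ) (α : ℤ) (f : PlaneModel) : Prop where
  /-- `U(2)_V`-weight `(1,1)`. -/
  row : ∀ a : Fin 2, fockOpTwB lam α (Matrix.single (Sum.inl a) (Sum.inl a) 1) f = f
  /-- `U(1)_V`-weight `−2`. -/
  wline : fockOpTwB lam α (Matrix.single (Sum.inr ()) (Sum.inr ()) 1) f = -((2 : ℂ) • f)
  /-- killed by the raising root operator. -/
  raise : fockOpTwB lam α (Matrix.single (Sum.inl 0) (Sum.inl 1) 1) f = 0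
  /-- killed by the lowering root operator. -/
  lower : fockOpTwB lam α (Matrix.single (Sum.inl 1) (Sum.inl 0) 1) f = 0

/-- The `κ`-conditions of the conjugate model in `ArchB`'s weight operators (KERNEL): row weights `α/2 − 2`, `w`-degree
`−3 − α/2`, killed by `E₋, E₊`. -/
theorem isKappaVectorTwB_iff_weightOp (lam : ℂ) (α : ℤ) (f : PlaneModel) :
    IsKappaVectorTwB lam α f ↔
      (∀ a : Fin 2, weightOp (rowWt a) f = ((α : ℂ) / 2 - 2) • f) ∧
      weightOp wWt f = (-3 - (α : ℂ) / 2) • f ∧ Eminus f = 0 ∧ Eplus f = 0 := by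
  constructor
  · rintro ⟨hr, hw, hp, hm⟩
    rw [fockOpTwB_single_offDiag lam α inl0_ne_inl1', fockOp_rho_plV_conj_raise, LinearMap.neg_apply, neg_eq_zero] at hp
    rw [fockOpTwB_single_offDiag lam α inl1_ne_inl0', fockOp_rho_plV_conj_lower, LinearMap.neg_apply, neg_eq_zero] at hm
    refine ⟨fun a => ?_, ?_, hp, hm⟩
    · have h := hr a
      rw [fockOpTwB_row, LinearMap.add_apply, LinearMap.neg_apply, LinearMap.smul_apply, Module.End.one_apply] at h
      calc weightOp (rowWt a) f
          = -(-weightOp (rowWt a) f + (-1 + (α : ℂ) / 2) • f) + (-1 + (α : ℂ) / 2) • f := by module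
        _ = -f + (-1 + (α : ℂ) / 2) • f := by rw [h]
        _ = ((α : ℂ) / 2 - 2) • f := by module
    · rw [fockOpTwB_wline, LinearMap.add_apply, LinearMap.smul_apply, Module.End.one_apply] at hw
      calc weightOp wWt f = (weightOp wWt f + (1 + (α : ℂ) / 2) • f) - (1 + (α : ℂ) / 2) • f := by module
        _ = -((2 : ℂ) • f) - (1 + (α : ℂ) / 2) • f := by rw [hw]
        _ = (-3 - (α : ℂ) / 2) • f := by module
  · rintro ⟨hr, hw, hp, hm⟩
    refine ⟨fun a => ?_, ?_, ?_, ?_⟩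
    · rw [fockOpTwB_row, LinearMap.add_apply, LinearMap.neg_apply, LinearMap.smul_apply, Module.End.one_apply, hr a]
      module
    · rw [fockOpTwB_wline, LinearMap.add_apply, LinearMap.smul_apply, Module.End.one_apply, hw]
      module
    · rw [fockOpTwB_single_offDiag lam α inl0_ne_inl1', fockOp_rho_plV_conj_raise, LinearMap.neg_apply, hp, neg_zero]
    · rw [fockOpTwB_single_offDiag lam α inl1_ne_inl0', fockOp_rho_plV_conj_lower, LinearMap.neg_apply, hm, neg_zero]

/-- (Ported verbatim from the HodgeCMPerL package; no docstring in the source.) -/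
private theorem wt_nonneg_of_nonneg' {σ : Type*} [Fintype σ] {s : σ → ℤ} (hs : ∀ i, 0 ≤ s i) (m : σ →₀ ℕ) :
    0 ≤ wt s m := by
  unfold wt
  exact Finset.sum_nonneg fun i _ => mul_nonneg (hs i) (Int.natCast_nonneg _)

/-- (Ported verbatim from the HodgeCMPerL package; no docstring in the source.) -/
private theorem rowWt_nonneg' (a : Fin 2) : ∀ i : PlaneVar, 0 ≤ rowWt a i
  | Sum.inl (a', _) => by
      simp only [rowWt]
      split_ifs <;> decide
  | Sum.inr _ => by simp [rowWt]

/-- (Ported verbatim from the HodgeCMPerL package; no docstring in the source.) -/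
private theorem wWt_nonneg' : ∀ i : PlaneVar, 0 ≤ wWt i
  | Sum.inl _ => by simp [wWt]
  | Sum.inr _ => by simp [wWt]

/-- **`κ` is never reachable in the conjugate model (KERNEL; adv2g23-O6 (R1), MODEL B)**: for EVERY twist `α ∈ ℤ` there is
no non-zero vector of `ρ^B_α`-weight `κ = (1,1;−2)` killed by the `𝔲(2)_V`-roots in `ℂ[z_{aj}, w_j]` — on a support monomial
the row weight `α/2 − 2` and the `w`-degree `−3 − α/2` would both be non-negative integers, i.e. `α ≥ 4 ∧ α ≤ −6`. -/
theorem not_exists_isKappaVectorTwB (lam : ℂ) (α : ℤ) : ¬ ∃ f : PlaneModel, f ≠ 0 ∧ IsKappaVectorTwB lam α f := by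
  rintro ⟨f, hf, hκ⟩
  rw [isKappaVectorTwB_iff_weightOp] at hκ
  obtain ⟨hr, hw, -, -⟩ := hκ
  obtain ⟨d, hd⟩ := MvPolynomial.ne_zero_iff.mp hf
  have h1 := congrArg (coeff d) (hr 0)
  have h2 := congrArg (coeff d) hw
  rw [coeff_weightOp, coeff_smul, smul_eq_mul] at h1 h2
  have e1 : (wt (rowWt 0) d : ℂ) = (α : ℂ) / 2 - 2 := mul_right_cancel₀ hd h1
  have e2 : (wt wWt d : ℂ) = -3 - (α : ℂ) / 2 := mul_right_cancel₀ hd h2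
  have i1 : ((2 * wt (rowWt 0) d + 4 - α : ℤ) : ℂ) = 0 := by push_cast; rw [e1]; ring
  have i2 : ((2 * wt wWt d + 6 + α : ℤ) : ℂ) = 0 := by push_cast; rw [e2]; ring
  have j1 : 2 * wt (rowWt 0) d + 4 - α = 0 := by exact_mod_cast i1
  have j2 : 2 * wt wWt d + 6 + α = 0 := by exact_mod_cast i2
  have n1 := wt_nonneg_of_nonneg' (rowWt_nonneg' 0) d
  have n2 := wt_nonneg_of_nonneg' wWt_nonneg' d
  omega

/-! ## 5. Both signs of `W_{ι₁}` in one statement (the shape requested in adv2g23-O6 (R1)) -/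

/-- The sign of the definite hermitian plane `W_{ι₁}` RELATIVE to the fixed additive character `ψ` of Adams's
dictionary (`pos` = model A = `planeWt`, `neg` = model B = `conjWt`; see the file docstring, "WHAT `PlaneSign` IS"). -/
inductive PlaneSign
  | pos
  | neg
  deriving DecidableEq

/-- The `κ`-conditions at `ι₁` for either sign of `W_{ι₁}` and any twist `α`: model A (`FockPrintTwist.IsKappaVectorTw`)
for `pos`, model B (`IsKappaVectorTwB`) for `neg`. -/
def IsKappaVectorSgn : PlaneSign → ℂ → ℤ → PlaneModel → Prop
  | PlaneSign.pos => IsKappaVectorTw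
  | PlaneSign.neg => IsKappaVectorTwB

/-- (Ported verbatim from the HodgeCMPerL package; no docstring in the source.) -/
@[simp] theorem isKappaVectorSgn_pos (lam : ℂ) (α : ℤ) (f : PlaneModel) :
    IsKappaVectorSgn PlaneSign.pos lam α f ↔ IsKappaVectorTw lam α f := Iff.rfl

/-- (Ported verbatim from the HodgeCMPerL package; no docstring in the source.) -/
@[simp] theorem isKappaVectorSgn_neg (lam : ℂ) (α : ℤ) (f : PlaneModel) :
    IsKappaVectorSgn PlaneSign.neg lam α f ↔ IsKappaVectorTwB lam α f := Iff.rfl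

/-- **Reachability of `κ = (1,1;−2)` at `ι₁` as a function of (sign of `W_{ι₁}`, twist `α`) (KERNEL)**: a non-zero
`κ`-vector exists iff `W_{ι₁}` is POSITIVE and `α ∈ {−2, 0}`. -/
theorem kappaReachable_iff (s : PlaneSign) (lam : ℂ) (α : ℤ) :
    (∃ f : PlaneModel, f ≠ 0 ∧ IsKappaVectorSgn s lam α f) ↔ (s = PlaneSign.pos ∧ (α = -2 ∨ α = 0)) := by
  cases s with
  | pos => simp only [isKappaVectorSgn_pos, exists_isKappaVectorTw_iff, true_and]
  | neg =>
      simp only [isKappaVectorSgn_neg, reduceCtorEq, false_and, iff_false]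
      exact not_exists_isKappaVectorTwB lam α

/-- **Corollary under the datum's constraint `α ∈ {±2}`** (adv2g23-O6: `α_{ι₁}(μ_W) = m_{ι₁}(Ψ₁) + m_{ι₁}(Ψ₂)` with equal
signs at `ι₁` — an INPUT here): a non-zero `κ`-vector exists iff `W_{ι₁}` is positive AND `α = −2`.  So both the sign of
`W_{ι₁}` and the label `(0,0;−2)` of PerL l. 506 are forced by `𝓕^κ_{ι₁} ≠ 0`. -/
theorem kappaReachable_iff_of_data (s : PlaneSign) (lam : ℂ) {α : ℤ} (hα : α = 2 ∨ α = -2) :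
    (∃ f : PlaneModel, f ≠ 0 ∧ IsKappaVectorSgn s lam α f) ↔ (s = PlaneSign.pos ∧ α = -2) := by
  rw [kappaReachable_iff]
  constructor
  · rintro ⟨hs, h⟩
    exact ⟨hs, by omega⟩
  · rintro ⟨hs, h⟩
    exact ⟨hs, Or.inl h⟩

end ConjPlane

end PrintDict
end Fock
end PerL34
end HodgeCM
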